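import Summits.Ventures.PercRepro.Night2ShapeOneSigma

/-!
# PercRepro — the seven-point shape (i): per-side bounds in the THIN-`H` regimes (night-2, gen 30)

When `H` is not the fat closure (`r_H ≤ 7/30`: `m_H ≥ 3`, or `H` a non-member) the capacity `11/18 − r_H` is at least
`17/45`, and a loss `(r_H + r_a + r_b − 11/18)⁺` of a side WITHOUT a fat face is at most `(r_a + r_b − 17/45)⁺ ≤
sigNF s_a + sigNF s_b` with `sigNF 1 = 32/720`, `sigNF 2 = 4/720`, `sigNF s = 0` for `s ≥ 3` (the σ-decomposition at
`cap/2 = 17/90`).  Per-side bounds (proofs/NIGHT-2-g30.md §3, NF1–NF3): **NF1** a non-fat side loads at most `100/720`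
(the configuration «two points attached to two different faces»: `(32 + 32 + 4)·…`); **NF2′** two visible `Z`-points and
`r_H ≤ 7/36` (`m_H ≥ 4`): at most `36/720`; **NF3′** two visible `Z`-points and a free `E`-point: at most `27/720`.
These feed the K-fat and no-fat couplings (Night2ShapeOneCouplingKF).
-/

namespace PercRepro.Shadow

/-- The thin-`H` σ-value of a face with `s` visible points off it: `(ρ(2 + s) − 17/90)⁺`. -/
def sigNF (s : ℕ) : ℚ := if s = 1 then 32 / 720 else if s = 2 then 4 / 720 else 0

/-- `sigNF s ≥ 0`. -/
theorem sigNF_nonneg (s : ℕ) : 0 ≤ sigNF s := by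
  unfold sigNF; split_ifs <;> norm_num

/-- `sigNF 0 = 0`. -/
theorem sigNF_zero : sigNF 0 = 0 := by unfold sigNF; norm_num
/-- `sigNF 1 = 32/720`. -/
theorem sigNF_one : sigNF 1 = 32 / 720 := by unfold sigNF; norm_num
/-- `sigNF 2 = 4/720`. -/
theorem sigNF_two : sigNF 2 = 4 / 720 := by unfold sigNF; norm_num
/-- `sigNF s = 0` for `s ≥ 3`. -/
theorem sigNF_of_three_le {s : ℕ} (h : 3 ≤ s) : sigNF s = 0 := by
  unfold sigNF; rw [if_neg (by omega), if_neg (by omega)]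
/-- `sigNF s ≤ 32/720` always. -/
theorem sigNF_le_one (s : ℕ) : sigNF s ≤ 32 / 720 := by
  unfold sigNF; split_ifs <;> norm_num
/-- `sigNF s ≤ 4/720` for `s ≥ 2`. -/
theorem sigNF_le_two {s : ℕ} (h : 2 ≤ s) : sigNF s ≤ 4 / 720 := by
  unfold sigNF; rw [if_neg (by omega)]; split_ifs <;> norm_num

/-- An admissible request `r ≤ ρ(2 + s)` (`r = 0` at a null face) satisfies `r − 17/90 ≤ sigNF s`. -/
theorem sub_le_sigNF {s : ℕ} {r : ℚ} (hr : r ≤ rhoReq (2 + s)) (h0 : s = 0 → r = 0) :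
    r - 17 / 90 ≤ sigNF s := by
  rcases Nat.lt_or_ge s 3 with hlt | hge
  · interval_cases s
    · rw [h0 rfl, sigNF_zero]; norm_num
    · rw [sigNF_one]; rw [show 2 + 1 = 3 from rfl, rhoReq_three] at hr; linarith
    · rw [sigNF_two]; rw [show 2 + 2 = 4 from rfl, rhoReq_four] at hr; linarith
  · rw [sigNF_of_three_le hge]
    have : rhoReq (2 + s) ≤ rhoReq 5 := rhoReq_anti (by omega)
    rw [rhoReq_five] at this
    linarith

/-- **The σ-decomposition of a loss in a thin-`H` regime** (`r_H ≤ 7/30`, no fat face): the loss of a source with faces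
`a`, `b` is at most `sigNF s_a + sigNF s_b`, and it vanishes when a face is null. -/
theorem lossNF_props {sa sb : ℕ} {rH ra rb : ℚ} (hH : rH ≤ 7 / 30) (hra : ra ≤ rhoReq (2 + sa)) (ha0 : sa = 0 → ra = 0)
    (hrb : rb ≤ rhoReq (2 + sb)) (hb0 : sb = 0 → rb = 0) :
    0 ≤ max (rH + ra + rb - 11 / 18) 0 ∧ max (rH + ra + rb - 11 / 18) 0 ≤ sigNF sa + sigNF sb ∧
      (sa = 0 ∨ sb = 0 → max (rH + ra + rb - 11 / 18) 0 = 0) := by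
  have h1 := sub_le_sigNF hra ha0
  have h2 := sub_le_sigNF hrb hb0
  have h3 := sigNF_nonneg sa
  have h4 := sigNF_nonneg sb
  have hat : ra ≤ 7 / 30 := req_le_thin_of_adm hra ha0
  have hbt : rb ≤ 7 / 30 := req_le_thin_of_adm hrb hb0
  refine ⟨le_max_right _ _, max_le (by linarith) (by linarith), ?_⟩
  rintro (h | h)
  · rw [ha0 h]; apply max_eq_right; linarith
  · rw [hb0 h]; apply max_eq_right; linarith

section Side

variable {fE a₁ a₂ a₃ zf z₁ z₂ z₃ s₁ s₂ s₃ g₁ g₂ g₃ : ℕ} {L₁ L₂ L₃ : ℚ}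

set_option maxHeartbeats 800000 in
/-- **NF1 (core).** A side without a fat face loads at most `100/720` in a thin-`H` regime. -/
theorem sideNF_core_P1
    (hs₁ : s₁ = fE + zf + (a₂ + z₂) + (a₃ + z₃)) (hs₂ : s₂ = fE + zf + (a₁ + z₁) + (a₃ + z₃))
    (hs₃ : s₃ = fE + zf + (a₁ + z₁) + (a₂ + z₂))
    (hg₁ : g₁ = 1 + fE + a₁ + zf + (z₁ + z₂ + z₃)) (hg₂ : g₂ = 1 + fE + a₂ + zf + (z₁ + z₂ + z₃))
    (hg₃ : g₃ = 1 + fE + a₃ + zf + (z₁ + z₂ + z₃))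
    (hL₁ : 0 ≤ L₁) (hB₁ : L₁ ≤ sigNF s₂ + sigNF s₃) (hn₁ : s₂ = 0 ∨ s₃ = 0 → L₁ = 0)
    (hL₂ : 0 ≤ L₂) (hB₂ : L₂ ≤ sigNF s₁ + sigNF s₃) (hn₂ : s₁ = 0 ∨ s₃ = 0 → L₂ = 0)
    (hL₃ : 0 ≤ L₃) (hB₃ : L₃ ≤ sigNF s₁ + sigNF s₂) (hn₃ : s₁ = 0 ∨ s₂ = 0 → L₃ = 0) :
    L₁ / (g₁ : ℚ) + L₂ / (g₂ : ℚ) + L₃ / (g₃ : ℚ) ≤ 100 / 720 := by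
  have hσ₁ := sigNF_nonneg s₁
  have hσ₂ := sigNF_nonneg s₂
  have hσ₃ := sigNF_nonneg s₃
  have hσ₁' := sigNF_le_one s₁
  have hσ₂' := sigNF_le_one s₂
  have hσ₃' := sigNF_le_one s₃
  have key : ∀ (tp tc td : ℚ) (bp bc bd : ℚ), tp ≤ bp → tc ≤ bc → td ≤ bd → bp + bc + bd ≤ 100 / 720 →
      tp + tc + td ≤ 100 / 720 := by intros; linarith
  rcases Nat.lt_or_ge (fE + zf) 1 with hf0 | hf1
  swap
  · -- `f ≥ 1`: every `s ≥ 1`, every `g ≥ 2`: three terms `≤ 64/720/2`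
    have t₁ := div_nat_le_div_of_le hL₁ (hB₁.trans (by linarith : sigNF s₂ + sigNF s₃ ≤ 64 / 720)) (g := g₁) (k := 2) (by norm_num) (by omega)
    have t₂ := div_nat_le_div_of_le hL₂ (hB₂.trans (by linarith : sigNF s₁ + sigNF s₃ ≤ 64 / 720)) (g := g₂) (k := 2) (by norm_num) (by omega)
    have t₃ := div_nat_le_div_of_le hL₃ (hB₃.trans (by linarith : sigNF s₁ + sigNF s₂ ≤ 64 / 720)) (g := g₃) (k := 2) (by norm_num) (by omega)
    exact key _ _ _ _ _ _ t₁ t₂ t₃ (by norm_num)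
  · have hfE : fE = 0 := by omega
    have hzf : zf = 0 := by omega
    by_cases hnull : s₁ = 0 ∨ s₂ = 0 ∨ s₃ = 0
    · -- a null face: one loading source, `B ≤ 64/720` over `g ≥ 2`... or `g ≥ 1` with `s = n_p`
      rcases hnull with h | h | h
      · rw [hn₂ (Or.inl h), hn₃ (Or.inl h), zero_div_nat, zero_div_nat]
        have hs₂' : s₂ = a₁ + z₁ := by omega
        have hs₃' : s₃ = a₁ + z₁ := by omega
        have t₁ := div_nat_le_div_of_le hL₁ (hB₁.trans (by rw [hs₂', hs₃']; linarith : sigNF s₂ + sigNF s₃ ≤ 2 * sigNF (a₁ + z₁)))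
          (g := g₁) (k := 1 + (a₁ + z₁)) (by omega) (by omega)
        have : 2 * sigNF (a₁ + z₁) / ((1 + (a₁ + z₁) : ℕ) : ℚ) ≤ 32 / 720 := by
          rcases Nat.lt_or_ge (a₁ + z₁) 3 with hlt | hge
          · interval_cases hn : (a₁ + z₁)
            · rw [sigNF_zero]; norm_num
            · rw [sigNF_one]; norm_num
            · rw [sigNF_two]; norm_num
          · rw [sigNF_of_three_le hge]; norm_num
        linarith
      · rw [hn₁ (Or.inl h), hn₃ (Or.inr h), zero_div_nat, zero_div_nat]
        have hs₁' : s₁ = a₂ + z₂ := by omega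
        have hs₃' : s₃ = a₂ + z₂ := by omega
        have t₂ := div_nat_le_div_of_le hL₂ (hB₂.trans (by rw [hs₁', hs₃']; linarith : sigNF s₁ + sigNF s₃ ≤ 2 * sigNF (a₂ + z₂)))
          (g := g₂) (k := 1 + (a₂ + z₂)) (by omega) (by omega)
        have : 2 * sigNF (a₂ + z₂) / ((1 + (a₂ + z₂) : ℕ) : ℚ) ≤ 32 / 720 := by
          rcases Nat.lt_or_ge (a₂ + z₂) 3 with hlt | hge
          · interval_cases hn : (a₂ + z₂)
            · rw [sigNF_zero]; norm_num
            · rw [sigNF_one]; norm_num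
            · rw [sigNF_two]; norm_num
          · rw [sigNF_of_three_le hge]; norm_num
        linarith
      · rw [hn₁ (Or.inr h), hn₂ (Or.inr h), zero_div_nat, zero_div_nat]
        have hs₁' : s₁ = a₃ + z₃ := by omega
        have hs₂' : s₂ = a₃ + z₃ := by omega
        have t₃ := div_nat_le_div_of_le hL₃ (hB₃.trans (by rw [hs₁', hs₂']; linarith : sigNF s₁ + sigNF s₂ ≤ 2 * sigNF (a₃ + z₃)))
          (g := g₃) (k := 1 + (a₃ + z₃)) (by omega) (by omega)
        have : 2 * sigNF (a₃ + z₃) / ((1 + (a₃ + z₃) : ℕ) : ℚ) ≤ 32 / 720 := by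
          rcases Nat.lt_or_ge (a₃ + z₃) 3 with hlt | hge
          · interval_cases hn : (a₃ + z₃)
            · rw [sigNF_zero]; norm_num
            · rw [sigNF_one]; norm_num
            · rw [sigNF_two]; norm_num
          · rw [sigNF_of_three_le hge]; norm_num
        linarith
    · push Not at hnull
      -- no null face: at most one `n_p = 0`; if `n_p = 0` the face `p` has `s ≥ 2`
      rcases Nat.eq_zero_or_pos (a₁ + z₁) with h1 | h1
      · have e₁ := sigNF_le_two (s := s₁) (by omega)
        have t₁ := div_nat_le_div_of_le hL₁ (hB₁.trans (by linarith : sigNF s₂ + sigNF s₃ ≤ 64 / 720)) (g := g₁) (k := 1) (by norm_num) (by omega)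
        have t₂ := div_nat_le_div_of_le hL₂ (hB₂.trans (by linarith : sigNF s₁ + sigNF s₃ ≤ 36 / 720)) (g := g₂) (k := 2) (by norm_num) (by omega)
        have t₃ := div_nat_le_div_of_le hL₃ (hB₃.trans (by linarith : sigNF s₁ + sigNF s₂ ≤ 36 / 720)) (g := g₃) (k := 2) (by norm_num) (by omega)
        exact key _ _ _ _ _ _ t₁ t₂ t₃ (by norm_num)
      · rcases Nat.eq_zero_or_pos (a₂ + z₂) with h2 | h2
        · have e₂ := sigNF_le_two (s := s₂) (by omega)
          have t₂ := div_nat_le_div_of_le hL₂ (hB₂.trans (by linarith : sigNF s₁ + sigNF s₃ ≤ 64 / 720)) (g := g₂) (k := 1) (by norm_num) (by omega)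
          have t₁ := div_nat_le_div_of_le hL₁ (hB₁.trans (by linarith : sigNF s₂ + sigNF s₃ ≤ 36 / 720)) (g := g₁) (k := 2) (by norm_num) (by omega)
          have t₃ := div_nat_le_div_of_le hL₃ (hB₃.trans (by linarith : sigNF s₁ + sigNF s₂ ≤ 36 / 720)) (g := g₃) (k := 2) (by norm_num) (by omega)
          exact key _ _ _ _ _ _ t₁ t₂ t₃ (by norm_num)
        · rcases Nat.eq_zero_or_pos (a₃ + z₃) with h3 | h3
          · have e₃ := sigNF_le_two (s := s₃) (by omega)
            have t₃ := div_nat_le_div_of_le hL₃ (hB₃.trans (by linarith : sigNF s₁ + sigNF s₂ ≤ 64 / 720)) (g := g₃) (k := 1) (by norm_num) (by omega)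
            have t₁ := div_nat_le_div_of_le hL₁ (hB₁.trans (by linarith : sigNF s₂ + sigNF s₃ ≤ 36 / 720)) (g := g₁) (k := 2) (by norm_num) (by omega)
            have t₂ := div_nat_le_div_of_le hL₂ (hB₂.trans (by linarith : sigNF s₁ + sigNF s₃ ≤ 36 / 720)) (g := g₂) (k := 2) (by norm_num) (by omega)
            exact key _ _ _ _ _ _ t₁ t₂ t₃ (by norm_num)
          · have e₁ := sigNF_le_two (s := s₁) (by omega)
            have e₂ := sigNF_le_two (s := s₂) (by omega)
            have e₃ := sigNF_le_two (s := s₃) (by omega)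
            have t₁ := div_nat_le_div_of_le hL₁ (hB₁.trans (by linarith : sigNF s₂ + sigNF s₃ ≤ 8 / 720)) (g := g₁) (k := 2) (by norm_num) (by omega)
            have t₂ := div_nat_le_div_of_le hL₂ (hB₂.trans (by linarith : sigNF s₁ + sigNF s₃ ≤ 8 / 720)) (g := g₂) (k := 2) (by norm_num) (by omega)
            have t₃ := div_nat_le_div_of_le hL₃ (hB₃.trans (by linarith : sigNF s₁ + sigNF s₂ ≤ 8 / 720)) (g := g₃) (k := 2) (by norm_num) (by omega)
            exact key _ _ _ _ _ _ t₁ t₂ t₃ (by norm_num)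

variable {r₁ r₂ r₃ rH : ℚ}

/-- A loss is at most `(7/36 + 7/30 + 7/30 − 11/18)⁺ = 36/720` when `r_H ≤ 7/36` and the faces request at most `7/30`. -/
theorem lossNF_le_of_rH_le {ra rb : ℚ} (hH : rH ≤ 7 / 36) (ha : ra ≤ 7 / 30) (hb : rb ≤ 7 / 30) :
    max (rH + ra + rb - 11 / 18) 0 ≤ 36 / 720 :=
  max_le (by linarith) (by norm_num)

/-- A loss is at most `36/720` when `r_H ≤ 7/30` and one face requests at most `7/36`. -/
theorem lossNF_le_of_one_small {ra rb : ℚ} (hH : rH ≤ 7 / 30) (ha : ra ≤ 7 / 30) (hb : rb ≤ 7 / 30)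
    (hsmall : ra ≤ 7 / 36 ∨ rb ≤ 7 / 36) : max (rH + ra + rb - 11 / 18) 0 ≤ 36 / 720 := by
  rcases hsmall with h | h
  · exact max_le (by linarith) (by norm_num)
  · exact max_le (by linarith) (by norm_num)

/-- **NF2′.** Two visible `Z`-points and `r_H ≤ 7/36`: the side loads at most `36/720`. -/
theorem sideNF_le_zeta2_rH36
    (hg₁ : g₁ = 1 + fE + a₁ + zf + (z₁ + z₂ + z₃)) (hg₂ : g₂ = 1 + fE + a₂ + zf + (z₁ + z₂ + z₃))
    (hg₃ : g₃ = 1 + fE + a₃ + zf + (z₁ + z₂ + z₃))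
    (hr₁ : r₁ ≤ rhoReq (2 + s₁)) (h₁0 : s₁ = 0 → r₁ = 0) (hr₂ : r₂ ≤ rhoReq (2 + s₂)) (h₂0 : s₂ = 0 → r₂ = 0)
    (hr₃ : r₃ ≤ rhoReq (2 + s₃)) (h₃0 : s₃ = 0 → r₃ = 0) (hH : rH ≤ 7 / 36) (hζ : 2 ≤ zf + (z₁ + z₂ + z₃)) :
    max (rH + r₂ + r₃ - 11 / 18) 0 / (g₁ : ℚ) + max (rH + r₁ + r₃ - 11 / 18) 0 / (g₂ : ℚ) +
      max (rH + r₁ + r₂ - 11 / 18) 0 / (g₃ : ℚ) ≤ 36 / 720 := by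
  have a₁t := req_le_thin_of_adm hr₁ h₁0
  have a₂t := req_le_thin_of_adm hr₂ h₂0
  have a₃t := req_le_thin_of_adm hr₃ h₃0
  have t₁ := div_nat_le_div_of_le (le_max_right _ _) (lossNF_le_of_rH_le hH a₂t a₃t) (g := g₁) (k := 3) (by norm_num) (by omega)
  have t₂ := div_nat_le_div_of_le (le_max_right _ _) (lossNF_le_of_rH_le hH a₁t a₃t) (g := g₂) (k := 3) (by norm_num) (by omega)
  have t₃ := div_nat_le_div_of_le (le_max_right _ _) (lossNF_le_of_rH_le hH a₁t a₂t) (g := g₃) (k := 3) (by norm_num) (by omega)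
  norm_num at t₁ t₂ t₃
  linarith

/-- **NF3′.** Two visible `Z`-points and a free `E`-point (`r_H ≤ 7/30`): the side loads at most `27/720`. -/
theorem sideNF_le_zeta2_fE1
    (hs₁ : s₁ = fE + zf + (a₂ + z₂) + (a₃ + z₃)) (hs₂ : s₂ = fE + zf + (a₁ + z₁) + (a₃ + z₃))
    (hs₃ : s₃ = fE + zf + (a₁ + z₁) + (a₂ + z₂))
    (hg₁ : g₁ = 1 + fE + a₁ + zf + (z₁ + z₂ + z₃)) (hg₂ : g₂ = 1 + fE + a₂ + zf + (z₁ + z₂ + z₃))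
    (hg₃ : g₃ = 1 + fE + a₃ + zf + (z₁ + z₂ + z₃))
    (hr₁ : r₁ ≤ rhoReq (2 + s₁)) (h₁0 : s₁ = 0 → r₁ = 0) (hr₂ : r₂ ≤ rhoReq (2 + s₂)) (h₂0 : s₂ = 0 → r₂ = 0)
    (hr₃ : r₃ ≤ rhoReq (2 + s₃)) (h₃0 : s₃ = 0 → r₃ = 0) (hH : rH ≤ 7 / 30) (hζ : 2 ≤ zf + (z₁ + z₂ + z₃))
    (hf : 1 ≤ fE) :
    max (rH + r₂ + r₃ - 11 / 18) 0 / (g₁ : ℚ) + max (rH + r₁ + r₃ - 11 / 18) 0 / (g₂ : ℚ) +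
      max (rH + r₁ + r₂ - 11 / 18) 0 / (g₃ : ℚ) ≤ 27 / 720 := by
  have a₁t := req_le_thin_of_adm hr₁ h₁0
  have a₂t := req_le_thin_of_adm hr₂ h₂0
  have a₃t := req_le_thin_of_adm hr₃ h₃0
  -- a face with `s ≥ 2` requests at most `7/36`
  have small : ∀ {s : ℕ} {r : ℚ}, r ≤ rhoReq (2 + s) → 2 ≤ s → r ≤ 7 / 36 := by
    intro s r hr hs
    have := rhoReq_anti (m := 4) (m' := 2 + s) (by omega)
    rw [rhoReq_four] at this
    linarith
  -- for each source one of its two faces has `s ≥ 2`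
  have h₁ : r₂ ≤ 7 / 36 ∨ r₃ ≤ 7 / 36 := by
    rcases Nat.lt_or_ge s₂ 2 with h | h
    · exact Or.inr (small hr₃ (by omega))
    · exact Or.inl (small hr₂ h)
  have h₂ : r₁ ≤ 7 / 36 ∨ r₃ ≤ 7 / 36 := by
    rcases Nat.lt_or_ge s₁ 2 with h | h
    · exact Or.inr (small hr₃ (by omega))
    · exact Or.inl (small hr₁ h)
  have h₃ : r₁ ≤ 7 / 36 ∨ r₂ ≤ 7 / 36 := by
    rcases Nat.lt_or_ge s₁ 2 with h | h
    · exact Or.inr (small hr₂ (by omega))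
    · exact Or.inl (small hr₁ h)
  have t₁ := div_nat_le_div_of_le (le_max_right _ _) (lossNF_le_of_one_small hH a₂t a₃t h₁) (g := g₁) (k := 4) (by norm_num) (by omega)
  have t₂ := div_nat_le_div_of_le (le_max_right _ _) (lossNF_le_of_one_small hH a₁t a₃t h₂) (g := g₂) (k := 4) (by norm_num) (by omega)
  have t₃ := div_nat_le_div_of_le (le_max_right _ _) (lossNF_le_of_one_small hH a₁t a₂t h₃) (g := g₃) (k := 4) (by norm_num) (by omega)
  norm_num at t₁ t₂ t₃
  linarith

end Side

end PercRepro.Shadow
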